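import Summits.Ventures.PercRepro.Night2LocalD3Coloops

/-!
# PercRepro — the maximal coloop count `kColoops G = |E ∖ G| − 1` is rigid (night-2, gen 12)

`kColoops_add_one_le_of_not_lay0` bounds the coloop count `k` of `M|G` by `d − 1` (`d = |E ∖ G| ≤ q`) as soon as a
member outside layer 0 exists, through the chain `q + 2 = ρ(E ∖ B) ≤ ρ((G ∖ K) ∪ (E ∖ G)) ≤ ρ(G ∖ K) + ρ(E ∖ G) ≤ (q + 1 − k) + d`.
When `k = d − 1` every inequality of the chain is an equality (`rigid_of_kColoops_add_one_eq`):

* `E ∖ G` is independent (`ρ(E ∖ G) = d`);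
* `(G ∖ K) ∪ (E ∖ G)` spans `M` — `E ∖ G` is skew to `G ∖ K`;
* every member outside layer 0 has `ρ(G ∖ B) = q + 1 − k` (its complement in `G` spans `G ∖ K` modulo `K`).

At `d = 3`, `q = 4`, `k = 2` (the cell left open by `localShadowHall_d3_zero` / `localShadowHall_of_card_le_kColoops`) this is the
skewness of `proofs/NIGHT-2-dq3.md` §5.1: `E ∖ G` is a basis-like triple skew to the plane `G ∖ K`, and a member `K ∪ B'` needs
`ρ(G ∖ B) = 3`.
-/

open scoped Matroid

namespace PercRepro.Shadow

open Finset PerFlat ThmH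

variable {α : Type*} [DecidableEq α] {M : Matroid α} [M.Finite]

section Rigid

variable {q : ℕ} {G : Finset α}

open scoped Classical in
/-- **Rigidity at the maximal coloop count**: if a member outside layer 0 exists at `|E ∖ G| = d ≤ q` with
`kColoops G + 1 = d`, then `E ∖ G` is independent, `(G ∖ K) ∪ (E ∖ G)` spans `M` and every member outside layer 0 has
`ρ(G ∖ B) = q + 1 − kColoops G`. -/
theorem rigid_of_kColoops_add_one_eq (hG : G ∈ flatsQ M (q + 1)) {d : ℕ} (hd : (gr M \ G).card = d)
    (hdq : d ≤ q) (hkd : kColoops M G + 1 = d) {B : Finset α} (hB : B ∈ membersIn M (Uq M (q + 2) q) G)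
    (hB0 : B ∉ lay0 M q G) :
    rkN M (gr M \ G) = d ∧
      rkN M ((G \ G.filter (fun y => y ∉ clF M (G.erase y))) ∪ (gr M \ G)) = q + 2 ∧
      rkN M (G \ B) + kColoops M G = q + 1 := by
  have hGg : G ⊆ gr M := (mem_flatsQ.1 hG).1
  have hGr : rkN M G = q + 1 := by
    have h := (mem_flatsQ.1 hG).2.2
    rw [eRk_eq_rkN] at h
    exact_mod_cast h
  set K := G.filter (fun y => y ∉ clF M (G.erase y)) with hKdef
  have hKB : K ⊆ B := coloops_subset_of_not_lay0 hG (hd ▸ hdq) hB hB0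
  have hBU : B ∈ Uq M (q + 2) q := (mem_membersIn.1 hB).1
  have hBG : B ⊆ G := (subset_clF hBU).trans (mem_membersIn.1 hB).2
  have hr : rkN M (gr M \ B) = q + 2 := by
    have h := (mem_Uq.1 hBU).2.2
    rw [eRk_eq_rkN] at h
    exact_mod_cast h
  have hGK : rkN M (G \ K) + K.card = q + 1 := by
    have h := eRk_eq_kColoops_add (M := M) hGg
    rw [← hKdef, eRk_eq_rkN, eRk_eq_rkN] at h
    have h' : rkN M G = K.card + rkN M (G \ K) := by exact_mod_cast h
    omega
  have hk : kColoops M G = K.card := by unfold kColoops; rw [← hKdef]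
  -- the chain
  have hsub : gr M \ B ⊆ (G \ K) ∪ (gr M \ G) := by
    intro x hx
    rw [Finset.mem_sdiff] at hx
    rw [Finset.mem_union, Finset.mem_sdiff, Finset.mem_sdiff]
    by_cases hxG : x ∈ G
    · left; exact ⟨hxG, fun hxK => hx.2 (hKB hxK)⟩
    · right; exact ⟨hx.1, hxG⟩
  have h1 : rkN M (gr M \ B) ≤ rkN M ((G \ K) ∪ (gr M \ G)) := rkN_mono hsub
  have h2 := rkN_inter_add_rkN_union_le (M := M) (G \ K) (gr M \ G)
  have h3 : rkN M (gr M \ G) ≤ d := hd ▸ rkN_le_card _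
  have h4 : rkN M ((G \ K) ∪ (gr M \ G)) ≤ rkN M (G \ K) + rkN M (gr M \ G) := by omega
  have hD : rkN M (gr M \ G) = d := by omega
  have hU : rkN M ((G \ K) ∪ (gr M \ G)) = q + 2 := by omega
  refine ⟨hD, hU, ?_⟩
  -- `ρ(G ∖ B) ≥ ρ(E ∖ B) − ρ(E ∖ G)` and `G ∖ B ⊆ G ∖ K`
  have hsplit : gr M \ B = (G \ B) ∪ (gr M \ G) := by
    ext x
    rw [Finset.mem_sdiff, Finset.mem_union, Finset.mem_sdiff, Finset.mem_sdiff]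
    constructor
    · intro hx
      by_cases hxG : x ∈ G
      · exact Or.inl ⟨hxG, hx.2⟩
      · exact Or.inr ⟨hx.1, hxG⟩
    · rintro (hx | hx)
      · exact ⟨hGg hx.1, hx.2⟩
      · exact ⟨hx.1, fun hxB => hx.2 (hBG hxB)⟩
  have h5 := rkN_inter_add_rkN_union_le (M := M) (G \ B) (gr M \ G)
  rw [← hsplit, hr] at h5
  have h6 : rkN M (G \ B) ≤ rkN M (G \ K) := rkN_mono (Finset.sdiff_subset_sdiff (Finset.Subset.refl _) hKB)
  omega

end Rigid

end PercRepro.Shadow
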